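import Literature.MathematicalPhysics.QuantumLattice.HubbardFermiLiquid
import Literature.MathematicalPhysics.QuantumLattice.FermionOperatorsProofs
import HarnessLib

/-!
# Relabelling the orbitals of a lattice fermion system: signed permutations of the Fock basis,
covariance of the Jordan–Wigner matrices, and the lattice symmetries of the Hubbard two-point function

Topic `MathematicalPhysics/QuantumLattice`; programme under the named fact `bgm_two_point_limit`
(`HubbardFermiLiquid.lean`; Benfatto–Giuliani–Mastropietro, Ann. Henri Poincaré 7 (2006) 809,
Thm. 1.1). The tree realises the CAR algebra of a finite orbital set `ι` concretely, as the
Jordan–Wigner matrices `annihilation i`, `creation i` on `ℓ²(𝒫 ι)` — a construction that USES a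
linear order on `ι` (the sign `jwSign i s = (-1)^{#{j ∈ s : j < i}}`). `FermionEmbedding.lean`
transports these matrices along ORDER embeddings only. Lattice symmetries of a periodic box —
translations and reflections of the discrete torus `(ℤ/Lℤ)^d`, spin exchange — are bijections of
the orbitals which are NOT monotone for the lexicographic order of `FermionTorus d L`, so a second
quantisation of arbitrary bijections is needed. This file provides it and PROVES:

* `invCount e s`, `relabelSign e s = (-1)^{invCount e s}` — the number of inversions of a bijection
  `e : ι ≃ ι'` on a configuration `s ⊆ ι` and its sign (the sign of the permutation sorting the
  `e`-image of the increasing list of `s`); the insertion rule `invCount_insert` and the KEY SIGN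
  IDENTITY `relabelSign_mul_jwSign_mul_relabelSign_insert`:
  `ε(s) · σ_i(s) · ε(s ∪ {i}) = σ_{e i}(e s)` for `i ∉ s`;
* `relabel e : Matrix (𝒫 ι) (𝒫 ι) ℂ ≃ₐ[ℂ] Matrix (𝒫 ι') (𝒫 ι') ℂ` — conjugation by the signed
  permutation matrix `|s⟩ ↦ ε(s) |e s⟩` (the Fock-space implementation `Γ(P_e)` of the
  one-particle permutation unitary, Bratteli–Robinson II Thm. 5.2.5 / §5.2.2: Bogoliubov
  transformations `a(f) ↦ a(Uf)` are unitarily implemented in the Fock representation), with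
  `relabel_annihilation : relabel e (c_i) = c_{e i}`, `relabel_creation`, `relabel_conjTranspose`,
  `trace_relabel`, `relabel_exp`, and the invariance of Gibbs states
  `gibbsState_relabel`, `thermalCorr_relabel` (`⟨e A e⁻¹⟩_{e H e⁻¹} = ⟨A⟩_H`);
* `Orb.mapEquiv f` — the orbital bijection `(x, σ) ↦ (f x, σ)` of a site bijection `f`, and the
  COVARIANCE OF THE HUBBARD HAMILTONIAN under graph isomorphisms
  (`relabel_hamiltonian`, `relabel_hamiltonianWith`: `Γ H_G Γ⁻¹ = H_{G'}` when `f : G ≅ G'`), and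
  under spin exchange (`relabel_spinSwap_hamiltonianWith`);
* for the finite-volume two-point function `hubbardThermalTwoPoint β U μ L x y σ σ'` of the fact
  `bgm_two_point_limit` (the 2D Hubbard torus): TRANSLATION INVARIANCE
  `hubbardThermalTwoPoint_add_right` (`⟨c†_{x+v,σ} c_{y+v,σ'}⟩_{β,L} = ⟨c†_{xσ} c_{yσ'}⟩_{β,L}`, hence
  `hubbardThermalTwoPoint_eq_sub`: it is a function of `y - x`), PARITY `hubbardThermalTwoPoint_neg`
  (`x, y ↦ -x, -y`) and SPIN-EXCHANGE invariance `hubbardThermalTwoPoint_spin_swap` — the lattice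
  symmetries (2.36a)/(4) "parity", (1) "spin exchange" and the translation invariance
  `S(𝐱, 𝐲) = S(𝐱 - 𝐲)` of BGM 2006 §1.2 (1.4), §2.1 (symmetries (1)–(5)), §2.2 ("the kernels … are
  translation invariant"), here for the interacting finite-volume Gibbs state with periodic
  boundary conditions, for all `β, U, μ, L`.

## Mathlib / tree search

Mathlib: `Matrix.reindexAlgEquiv` (relabelling rows/columns along an `Equiv`), `Equiv.finsetCongr`,
`SimpleGraph.circulantGraph_adj_translate` (the torus graph is Mathlib's circulant graph),
`NormedSpace.map_exp`. Tree: `annihilation_apply`, `creation`, `jwSign` (`HubbardWave0`,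
`FermionOperatorsProofs`), `numberAt_commute` (`FermionOperators`), `gibbsState_apply`, `thermalCorr`
(`FinDimSpectrum`), `FermionTorus.equivTorusSite`, `fermionTorusGraph_adj` (`HubbardModel`),
`hubbardThermalTwoPoint` (`HubbardFermiLiquid`); `jwEmbed` (`FermionEmbedding`, order embeddings
only — `lean search 'relabel|Perm.sign.*Fock|translation.*creation'` found no relabelling along
non-monotone maps).

## References

* O. Bratteli, D. W. Robinson, *Operator Algebras and Quantum Statistical Mechanics II*, 2nd ed.
  (Springer 1997), §5.2.2, Thm. 5.2.5 (Fock representation; Bogoliubov transformations induced by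
  one-particle unitaries, here permutations, are unitarily implemented). [BratteliRobinsonII1997]
* G. Benfatto, A. Giuliani, V. Mastropietro, Ann. Henri Poincaré 7 (2006) 809–898, §1.2 (1.4),
  §2.1 (symmetries (1) spin exchange, (4) parity), §2.2. [BenfattoGiulianiMastropietro2006]
-/

noncomputable section

namespace Literature.MathematicalPhysics.QuantumLattice

open Matrix Finset HubbardWave0 Literature.Probability.LatticeModels

/-! ### Inversions of a bijection on a configuration and the relabelling sign -/

section Sign

variable {ι ι' : Type*} [LinearOrder ι] [LinearOrder ι']

/-- The number of inversions of the bijection `e` on the configuration `s`: ordered pairs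
`j < k` in `s` with `e k < e j`. [folklore] -/
def invCount (e : ι ≃ ι') (s : Finset ι) : ℕ := ∑ j ∈ s, (s.filter fun k => j < k ∧ e k < e j).card

/-- The relabelling sign `ε_e(s) = (-1)^{#inversions}`: the sign of the permutation that sorts
the `e`-images of the increasing enumeration of `s`. [cite: BratteliRobinsonII1997, §5.2.2 (Jordan–Wigner transformation)] -/
def relabelSign (e : ι ≃ ι') (s : Finset ι) : ℂ := (-1) ^ invCount e s

/-- `ε(s)² = 1`. [folklore] -/
theorem relabelSign_mul_self (e : ι ≃ ι') (s : Finset ι) : relabelSign e s * relabelSign e s = 1 := by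
  rw [relabelSign, ← pow_add, ← two_mul, pow_mul]
  norm_num

/-- The relabelling sign is real. [folklore] -/
theorem star_relabelSign (e : ι ≃ ι') (s : Finset ι) : star (relabelSign e s) = relabelSign e s := by
  simp [relabelSign]

/-- **Insertion rule for inversions.** Adding an orbital `i ∉ s` creates the inversions `(i, k)`
with `i < k`, `e k < e i` and `(j, i)` with `j < i`, `e i < e j`. [folklore] -/
theorem invCount_insert (e : ι ≃ ι') {i : ι} {s : Finset ι} (hi : i ∉ s) :
    invCount e (insert i s) = invCount e s + (s.filter fun k => i < k ∧ e k < e i).card +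
      (s.filter fun j => j < i ∧ e i < e j).card := by
  unfold invCount
  rw [Finset.sum_insert hi]
  have h1 : ((insert i s).filter fun k => i < k ∧ e k < e i) = s.filter fun k => i < k ∧ e k < e i := by
    rw [Finset.filter_insert, if_neg (fun h => lt_irrefl _ h.1)]
  have h2 : ∀ j ∈ s, ((insert i s).filter fun k => j < k ∧ e k < e j).card =
      (s.filter fun k => j < k ∧ e k < e j).card + if j < i ∧ e i < e j then 1 else 0 := by
    intro j _
    rw [Finset.filter_insert]
    split_ifs with h
    · rw [Finset.card_insert_of_notMem (fun h' => hi (Finset.mem_filter.1 h').1)]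
    · rw [add_zero]
  rw [h1, Finset.sum_congr rfl h2, Finset.sum_add_distrib, ← Finset.card_filter]
  ring

/-- For `i ∉ s`, the orbitals of `s` below `i` split according to the position of their images
relative to `e i`. [folklore] -/
theorem card_filter_lt_eq_add (e : ι ≃ ι') {i : ι} {s : Finset ι} (hi : i ∉ s) :
    (s.filter fun j => j < i).card =
      (s.filter fun j => j < i ∧ e j < e i).card + (s.filter fun j => j < i ∧ e i < e j).card := by
  rw [← Finset.card_filter_add_card_filter_not (s := s.filter fun j => j < i)
    (p := fun j => e j < e i), Finset.filter_filter, Finset.filter_filter]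
  congr 2
  refine Finset.filter_congr fun j hj => ?_
  have hne : e j ≠ e i := fun h => hi (by rwa [← e.injective h])
  constructor
  · rintro ⟨hji, hn⟩
    exact ⟨hji, lt_of_le_of_ne (not_lt.1 hn) hne.symm⟩
  · rintro ⟨hji, hlt⟩
    exact ⟨hji, not_lt.2 hlt.le⟩

/-- For `i ∉ s`, the orbitals of `s` whose image lies below `e i` split according to their
position relative to `i`. [folklore] -/
theorem card_filter_apply_lt_eq_add (e : ι ≃ ι') {i : ι} {s : Finset ι} (hi : i ∉ s) :
    (s.filter fun j => e j < e i).card =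
      (s.filter fun j => j < i ∧ e j < e i).card + (s.filter fun k => i < k ∧ e k < e i).card := by
  rw [← Finset.card_filter_add_card_filter_not (s := s.filter fun j => e j < e i)
    (p := fun j => j < i), Finset.filter_filter, Finset.filter_filter]
  congr 1
  · congr 1
    exact Finset.filter_congr fun j _ => and_comm
  · congr 1
    refine Finset.filter_congr fun j hj => ?_
    have hne : j ≠ i := fun h => hi (h ▸ hj)
    constructor
    · rintro ⟨hlt, hn⟩
      exact ⟨lt_of_le_of_ne (not_lt.1 hn) hne.symm, hlt⟩
    · rintro ⟨hij, hlt⟩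
      exact ⟨hlt, not_lt.2 hij.le⟩

/-- **The key sign identity.** For `i ∉ s`:
`ε(s) · σ_i(s) · ε(insert i s) = σ_{e i}(e(s))`, where `σ_i(s) = (-1)^{#{j ∈ s : j < i}}` is the
Jordan–Wigner sign — moving the relabelled orbital into place costs exactly the Jordan–Wigner sign
in the new order. [cite: BratteliRobinsonII1997, §5.2.2 (Jordan–Wigner transformation)] -/
theorem relabelSign_mul_jwSign_mul_relabelSign_insert (e : ι ≃ ι') {i : ι} {s : Finset ι}
    (hi : i ∉ s) :
    relabelSign e s * jwSign i s * relabelSign e (insert i s) =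
      jwSign (e i) (s.map e.toEmbedding) := by
  have hmap : ((s.map e.toEmbedding).filter fun j' => j' < e i).card =
      (s.filter fun j => e j < e i).card := by
    rw [Finset.filter_map, Finset.card_map]
    rfl
  unfold relabelSign jwSign
  rw [hmap, invCount_insert e hi, card_filter_lt_eq_add e hi, card_filter_apply_lt_eq_add e hi,
    ← pow_add, ← pow_add]
  set A₁ := (s.filter fun j => j < i ∧ e j < e i).card
  set A₂ := (s.filter fun j => j < i ∧ e i < e j).card
  set B₂ := (s.filter fun k => i < k ∧ e k < e i).card
  set n := invCount e s
  have h : n + (A₁ + A₂) + (n + B₂ + A₂) = 2 * (n + A₂) + (A₁ + B₂) := by ring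
  rw [h, pow_add, pow_mul, neg_one_sq, one_pow, one_mul]

end Sign

/-! ### Two bookkeeping lemmas on `Equiv.finsetCongr` -/

section FinsetCongr

variable {α α' : Type*} (e : α ≃ α')

/-- The relabelled configuration of `insert i s` is `insert (e i)` of the relabelled `s`. [folklore] -/
theorem finsetCongr_insert [DecidableEq α] [DecidableEq α'] (i : α) (s : Finset α) :
    e.finsetCongr (insert i s) = insert (e i) (e.finsetCongr s) := by
  rw [Equiv.finsetCongr_apply, Equiv.finsetCongr_apply, Finset.map_insert]
  rfl

/-- `e i ∈ e(s) ↔ i ∈ s`. [folklore] -/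
theorem apply_mem_finsetCongr (i : α) (s : Finset α) : e i ∈ e.finsetCongr s ↔ i ∈ s := by
  rw [Equiv.finsetCongr_apply]
  exact Finset.mem_map' e.toEmbedding

end FinsetCongr

/-! ### The relabelling as an algebra equivalence of the Fock-space matrix algebras -/

section Relabel

variable {ι ι' : Type*} [LinearOrder ι] [LinearOrder ι'] [Fintype ι] [Fintype ι'] (e : ι ≃ ι')

/-- The diagonal matrix of relabelling signs `D = diag(ε_e(s))` (an involution, `D² = 1`). [folklore] -/
def relabelSignMatrix : Matrix (Finset ι) (Finset ι) ℂ := diagonal (relabelSign e)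

omit [Fintype ι'] in
/-- `D² = 1`. [folklore] -/
theorem relabelSignMatrix_mul_self : relabelSignMatrix e * relabelSignMatrix e = 1 := by
  rw [relabelSignMatrix, diagonal_mul_diagonal, ← diagonal_one]
  congr 1
  funext s
  exact relabelSign_mul_self e s

omit [Fintype ι'] in
/-- `D (D X) = X`. [folklore] -/
theorem relabelSignMatrix_mul_relabelSignMatrix_mul (X : Matrix (Finset ι) (Finset ι) ℂ) :
    relabelSignMatrix e * (relabelSignMatrix e * X) = X := by
  rw [← Matrix.mul_assoc, relabelSignMatrix_mul_self, Matrix.one_mul]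

/-- Conjugation by the sign involution `D`, `a ↦ D a D`, as an algebra automorphism. [folklore] -/
def relabelSignConj : Matrix (Finset ι) (Finset ι) ℂ ≃ₐ[ℂ] Matrix (Finset ι) (Finset ι) ℂ where
  toFun a := relabelSignMatrix e * a * relabelSignMatrix e
  invFun a := relabelSignMatrix e * a * relabelSignMatrix e
  left_inv a := by
    show relabelSignMatrix e * (relabelSignMatrix e * a * relabelSignMatrix e) * relabelSignMatrix e = a
    rw [← Matrix.mul_assoc, ← Matrix.mul_assoc, relabelSignMatrix_mul_self, Matrix.one_mul,
      Matrix.mul_assoc, relabelSignMatrix_mul_self, Matrix.mul_one]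
  right_inv a := by
    show relabelSignMatrix e * (relabelSignMatrix e * a * relabelSignMatrix e) * relabelSignMatrix e = a
    rw [← Matrix.mul_assoc, ← Matrix.mul_assoc, relabelSignMatrix_mul_self, Matrix.one_mul,
      Matrix.mul_assoc, relabelSignMatrix_mul_self, Matrix.mul_one]
  map_mul' a b := by
    show relabelSignMatrix e * (a * b) * relabelSignMatrix e =
      relabelSignMatrix e * a * relabelSignMatrix e * (relabelSignMatrix e * b * relabelSignMatrix e)
    simp only [Matrix.mul_assoc, relabelSignMatrix_mul_relabelSignMatrix_mul]
  map_add' a b := by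
    show relabelSignMatrix e * (a + b) * relabelSignMatrix e = _
    rw [Matrix.mul_add, Matrix.add_mul]
  commutes' c := by
    show relabelSignMatrix e * algebraMap ℂ _ c * relabelSignMatrix e = algebraMap ℂ _ c
    rw [Algebra.algebraMap_eq_smul_one, Matrix.mul_smul, Matrix.mul_one, Matrix.smul_mul,
      relabelSignMatrix_mul_self]

/-- **Second quantisation of an arbitrary orbital bijection `e : ι ≃ ι'`**: conjugation by the
signed permutation matrix `|s⟩ ↦ ε_e(s) |e(s)⟩` of the occupation bases, as an algebra equivalence
`Matrix (𝒫 ι) ≃ₐ Matrix (𝒫 ι')` (sign conjugation followed by Mathlib's `reindexAlgEquiv` along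
`e.finsetCongr`). [cite: BratteliRobinsonII1997, §5.2.2, Thm. 5.2.5 (Fock representation; unitarily implemented Bogoliubov transformations)] -/
def relabel : Matrix (Finset ι) (Finset ι) ℂ ≃ₐ[ℂ] Matrix (Finset ι') (Finset ι') ℂ :=
  (relabelSignConj e).trans (Matrix.reindexAlgEquiv ℂ ℂ e.finsetCongr)

/-- The entries of the relabelled matrix on the relabelled configurations:
`(Γ a Γ⁻¹)_{e s, e t} = ε(s) a_{s t} ε(t)`. [folklore] -/
theorem relabel_apply_finsetCongr (a : Matrix (Finset ι) (Finset ι) ℂ) (s t : Finset ι) :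
    relabel e a (e.finsetCongr s) (e.finsetCongr t) = relabelSign e s * a s t * relabelSign e t := by
  show (Matrix.reindexAlgEquiv ℂ ℂ e.finsetCongr (relabelSignMatrix e * a * relabelSignMatrix e))
    (e.finsetCongr s) (e.finsetCongr t) = _
  rw [Matrix.coe_reindexAlgEquiv, Matrix.reindex_apply, Matrix.submatrix_apply,
    Equiv.symm_apply_apply, Equiv.symm_apply_apply, relabelSignMatrix, Matrix.mul_diagonal,
    Matrix.diagonal_mul]

/-- **`Γ c_i Γ⁻¹ = c_{e i}`**: the relabelling sends the Jordan–Wigner annihilation operator of `i`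
(for the order of `ι`) to that of `e i` (for the order of `ι'`).
[cite: BratteliRobinsonII1997, §5.2.2, Thm. 5.2.5 and eq. (5.2.13)] -/
theorem relabel_annihilation (i : ι) : relabel e (annihilation i) = annihilation (e i) := by
  ext s' t'
  obtain ⟨s, rfl⟩ := e.finsetCongr.surjective s'
  obtain ⟨t, rfl⟩ := e.finsetCongr.surjective t'
  rw [relabel_apply_finsetCongr, annihilation_apply, annihilation_apply]
  by_cases h : i ∉ s ∧ t = insert i s
  · obtain ⟨hi, rfl⟩ := h
    have h' : e i ∉ e.finsetCongr s ∧ e.finsetCongr (insert i s) = insert (e i) (e.finsetCongr s) :=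
      ⟨fun hm => hi ((apply_mem_finsetCongr e i s).1 hm), finsetCongr_insert e i s⟩
    rw [if_pos ⟨hi, rfl⟩, if_pos h', Equiv.finsetCongr_apply,
      ← relabelSign_mul_jwSign_mul_relabelSign_insert e hi]
  · have h' : ¬(e i ∉ e.finsetCongr s ∧ e.finsetCongr t = insert (e i) (e.finsetCongr s)) := by
      rintro ⟨h1, h2⟩
      exact h ⟨fun hm => h1 ((apply_mem_finsetCongr e i s).2 hm),
        e.finsetCongr.injective (h2.trans (finsetCongr_insert e i s).symm)⟩
    rw [if_neg h, if_neg h', mul_zero, zero_mul]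

/-- The relabelling is a `*`-map: `Γ aᴴ Γ⁻¹ = (Γ a Γ⁻¹)ᴴ` (the signed permutation is a real
orthogonal matrix). [folklore] -/
theorem relabel_conjTranspose (a : Matrix (Finset ι) (Finset ι) ℂ) :
    relabel e aᴴ = (relabel e a)ᴴ := by
  ext s' t'
  obtain ⟨s, rfl⟩ := e.finsetCongr.surjective s'
  obtain ⟨t, rfl⟩ := e.finsetCongr.surjective t'
  rw [conjTranspose_apply, relabel_apply_finsetCongr, relabel_apply_finsetCongr,
    conjTranspose_apply, star_mul, star_mul, star_relabelSign, star_relabelSign]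
  ring

/-- **`Γ c†_i Γ⁻¹ = c†_{e i}`.** [cite: BratteliRobinsonII1997, §5.2.2, Thm. 5.2.5 and eq. (5.2.13)] -/
theorem relabel_creation (i : ι) : relabel e (creation i) = creation (e i) := by
  rw [creation, relabel_conjTranspose, relabel_annihilation, creation]

/-- **The trace is invariant under relabelling**, `Tr (Γ a Γ⁻¹) = Tr a`. [folklore] -/
theorem trace_relabel (a : Matrix (Finset ι) (Finset ι) ℂ) : (relabel e a).trace = a.trace := by
  simp only [Matrix.trace]
  rw [← e.finsetCongr.sum_comp]
  refine Finset.sum_congr rfl fun s _ => ?_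
  rw [Matrix.diag_apply, Matrix.diag_apply, relabel_apply_finsetCongr, mul_comm (relabelSign e s),
    mul_assoc, relabelSign_mul_self, mul_one]

/-- The relabelling is continuous (finite dimensions). [folklore] -/
theorem continuous_relabel : Continuous (relabel e) :=
  (relabel e).toLinearMap.continuous_of_finiteDimensional

/-- **The relabelling commutes with the matrix exponential.** [folklore] -/
theorem relabel_exp (X : Matrix (Finset ι) (Finset ι) ℂ) :
    relabel e (NormedSpace.exp X) = NormedSpace.exp (relabel e X) :=
  open scoped Matrix.Norms.Operator in NormedSpace.map_exp (relabel e) (continuous_relabel e) X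

/-- Gibbs weights are covariant: `e^{-β ΓHΓ⁻¹} = Γ e^{-βH} Γ⁻¹`. [folklore] -/
theorem gibbsWeight_relabel (β : ℝ) (H : Matrix (Finset ι) (Finset ι) ℂ) :
    gibbsWeight β (relabel e H) = relabel e (gibbsWeight β H) := by
  rw [gibbsWeight, gibbsWeight, relabel_exp, map_smul]

/-- Partition functions are invariant: `Tr e^{-β ΓHΓ⁻¹} = Tr e^{-βH}`. [folklore] -/
theorem partitionFn_relabel (β : ℝ) (H : Matrix (Finset ι) (Finset ι) ℂ) :
    partitionFn β (relabel e H) = partitionFn β H := by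
  rw [partitionFn, partitionFn, gibbsWeight_relabel, trace_relabel]

/-- **Gibbs states are covariant under relabelling**: `⟨Γ A Γ⁻¹⟩_{β, ΓHΓ⁻¹} = ⟨A⟩_{β, H}`.
[cite: BratteliRobinsonII1997, §5.2.2, Thm. 5.2.5] -/
theorem gibbsState_relabel (β : ℝ) (H A : Matrix (Finset ι) (Finset ι) ℂ) :
    gibbsState β (relabel e H) (relabel e A) = gibbsState β H A := by
  rw [gibbsState_apply, gibbsState_apply, gibbsWeight_relabel, ← map_mul, trace_relabel,
    partitionFn_relabel]

/-- **Thermal correlations are covariant under relabelling**: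
`⟨Γ A Γ⁻¹ · Γ B Γ⁻¹⟩_{β, ΓHΓ⁻¹} = ⟨A B⟩_{β, H}`. [cite: BratteliRobinsonII1997, §5.2.2, Thm. 5.2.5] -/
theorem thermalCorr_relabel (β : ℝ) (H A B : Matrix (Finset ι) (Finset ι) ℂ) :
    thermalCorr β (relabel e H) (relabel e A) (relabel e B) = thermalCorr β H A B := by
  rw [thermalCorr, thermalCorr, ← map_mul, gibbsState_relabel]

end Relabel

/-! ### Site bijections, spin exchange, and the covariance of the Hubbard Hamiltonian -/

section OrbMaps

variable {Λ Λ' : Type*}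

/-- The orbital bijection `(x, σ) ↦ (f x, σ)` induced by a site bijection `f`. [folklore] -/
def Orb.mapEquiv (f : Λ ≃ Λ') : Orb Λ ≃ Orb Λ' :=
  (ofLex : Lex (Λ × Fin 2) ≃ Λ × Fin 2).trans ((f.prodCongr (Equiv.refl (Fin 2))).trans toLex)

/-- `Orb.mapEquiv f (x, σ) = (f x, σ)`. [folklore] -/
@[simp] theorem Orb.mapEquiv_orb (f : Λ ≃ Λ') (x : Λ) (σ : Fin 2) :
    Orb.mapEquiv f (orb x σ) = orb (f x) σ := rfl

/-- The orbital bijection `(x, σ) ↦ (x, 1 - σ)` exchanging the two spin values. [folklore] -/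
def Orb.spinSwap : Orb Λ ≃ Orb Λ :=
  (ofLex : Lex (Λ × Fin 2) ≃ Λ × Fin 2).trans
    (((Equiv.refl Λ).prodCongr (Equiv.swap (0 : Fin 2) 1)).trans toLex)

/-- `Orb.spinSwap (x, σ) = (x, swap σ)`. [folklore] -/
theorem Orb.spinSwap_orb (x : Λ) (σ : Fin 2) :
    (Orb.spinSwap : Orb Λ ≃ Orb Λ) (orb x σ) = orb x (Equiv.swap (0 : Fin 2) 1 σ) := rfl

end OrbMaps

section Hubbard

variable {Λ Λ' : Type*} [LinearOrder Λ] [LinearOrder Λ'] [Fintype Λ] [Fintype Λ']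

/-- Number operators are covariant: `Γ n_{xσ} Γ⁻¹ = n_{f x, σ}`. [folklore] -/
theorem relabel_mapEquiv_numberOp (f : Λ ≃ Λ') (x : Λ) (σ : Fin 2) :
    relabel (Orb.mapEquiv f) (numberOp x σ) = numberOp (f x) σ := by
  rw [numberOp, numberOp, map_mul, relabel_creation, relabel_annihilation, Orb.mapEquiv_orb]

/-- The total particle number is invariant under site bijections. [folklore] -/
theorem relabel_mapEquiv_totalNumber (f : Λ ≃ Λ') :
    relabel (Orb.mapEquiv f) (totalNumber : Matrix (Finset (Orb Λ)) (Finset (Orb Λ)) ℂ) =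
      totalNumber := by
  rw [totalNumber, totalNumber, map_sum]
  simp_rw [map_sum, relabel_mapEquiv_numberOp]
  exact f.sum_comp (fun x' => ∑ σ : Fin 2, numberOp x' σ)

variable (G : SimpleGraph Λ) [DecidableRel G.Adj] (G' : SimpleGraph Λ') [DecidableRel G'.Adj]

/-- **Covariance of the Hubbard Hamiltonian under graph isomorphisms**: if the site bijection `f`
carries the adjacency of `G` onto that of `G'`, then `Γ_f H_G(t, U) Γ_f⁻¹ = H_{G'}(t, U)`.
[folklore] -/
theorem relabel_hamiltonian (f : Λ ≃ Λ') (hG : ∀ x y, G'.Adj (f x) (f y) ↔ G.Adj x y) (t U : ℝ) :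
    relabel (Orb.mapEquiv f) (hamiltonian G t U) = hamiltonian G' t U := by
  unfold hamiltonian
  rw [map_add, map_smul, map_smul, map_sum, map_sum]
  congr 2
  · simp_rw [map_sum]
    rw [← f.sum_comp]
    refine Finset.sum_congr rfl fun x _ => ?_
    rw [← f.sum_comp]
    refine Finset.sum_congr rfl fun y _ => Finset.sum_congr rfl fun σ _ => ?_
    by_cases hadj : G.Adj x y
    · rw [if_pos hadj, if_pos ((hG x y).2 hadj), map_mul, relabel_creation, relabel_annihilation,
        Orb.mapEquiv_orb, Orb.mapEquiv_orb]
    · rw [if_neg hadj, if_neg (fun h => hadj ((hG x y).1 h)), map_zero]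
  · rw [← f.sum_comp]
    refine Finset.sum_congr rfl fun x _ => ?_
    rw [map_mul, relabel_mapEquiv_numberOp, relabel_mapEquiv_numberOp]

/-- **Covariance of the grand-canonical Hubbard Hamiltonian** `H_G(t,U) - μN` under graph
isomorphisms. [folklore] -/
theorem relabel_hamiltonianWith (f : Λ ≃ Λ') (hG : ∀ x y, G'.Adj (f x) (f y) ↔ G.Adj x y)
    (t U μ : ℝ) :
    relabel (Orb.mapEquiv f) (hamiltonianWith G t U μ) = hamiltonianWith G' t U μ := by
  rw [hamiltonianWith, hamiltonianWith, map_sub, map_smul, relabel_hamiltonian G G' f hG,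
    relabel_mapEquiv_totalNumber]

/-- Spin exchange fixes the on-site interaction `n_{x↑} n_{x↓}` (the two number operators
commute). [cite: BenfattoGiulianiMastropietro2006, §2.1 (symmetry (1), spin exchange)] -/
theorem relabel_spinSwap_numberOp_mul_numberOp (x : Λ) :
    relabel (Orb.spinSwap : Orb Λ ≃ Orb Λ) (numberOp x 0 * numberOp x 1) = numberOp x 0 * numberOp x 1 := by
  rw [map_mul, numberOp, numberOp, map_mul, map_mul, relabel_creation, relabel_annihilation,
    relabel_creation, relabel_annihilation, Orb.spinSwap_orb, Orb.spinSwap_orb,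
    Equiv.swap_apply_left, Equiv.swap_apply_right, ← numberOp, ← numberOp, ← numberAt_orb,
    ← numberAt_orb]
  exact (numberAt_commute _ _).eq

/-- **Spin-exchange invariance of the grand-canonical Hubbard Hamiltonian** on any finite graph.
[cite: BenfattoGiulianiMastropietro2006, §2.1 (symmetry (1), spin exchange)] -/
theorem relabel_spinSwap_hamiltonianWith (t U μ : ℝ) :
    relabel (Orb.spinSwap : Orb Λ ≃ Orb Λ) (hamiltonianWith G t U μ) = hamiltonianWith G t U μ := by
  have hN : relabel (Orb.spinSwap : Orb Λ ≃ Orb Λ)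
      (totalNumber : Matrix (Finset (Orb Λ)) (Finset (Orb Λ)) ℂ) = totalNumber := by
    rw [totalNumber, map_sum]
    refine Finset.sum_congr rfl fun x _ => ?_
    rw [map_sum]
    refine Fintype.sum_equiv (Equiv.swap (0 : Fin 2) 1) _ _ fun σ => ?_
    rw [numberOp, map_mul, relabel_creation, relabel_annihilation, Orb.spinSwap_orb, numberOp]
  have hT : relabel (Orb.spinSwap : Orb Λ ≃ Orb Λ)
      (∑ x : Λ, ∑ y : Λ, ∑ σ : Fin 2,
        if G.Adj x y then creation (orb x σ) * annihilation (orb y σ) else 0) =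
      ∑ x : Λ, ∑ y : Λ, ∑ σ : Fin 2,
        if G.Adj x y then creation (orb x σ) * annihilation (orb y σ) else 0 := by
    rw [map_sum]
    refine Finset.sum_congr rfl fun x _ => ?_
    rw [map_sum]
    refine Finset.sum_congr rfl fun y _ => ?_
    rw [map_sum]
    refine Fintype.sum_equiv (Equiv.swap (0 : Fin 2) 1) _ _ fun σ => ?_
    by_cases hadj : G.Adj x y
    · rw [if_pos hadj, if_pos hadj, map_mul, relabel_creation, relabel_annihilation,
        Orb.spinSwap_orb, Orb.spinSwap_orb]
    · rw [if_neg hadj, if_neg hadj, map_zero]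
  have hV : relabel (Orb.spinSwap : Orb Λ ≃ Orb Λ) (∑ x : Λ, numberOp x 0 * numberOp x 1) =
      ∑ x : Λ, numberOp x 0 * numberOp x 1 := by
    rw [map_sum]
    exact Finset.sum_congr rfl fun x _ => relabel_spinSwap_numberOp_mul_numberOp x
  rw [hamiltonianWith, hamiltonian, map_sub, map_add, map_smul, map_smul, map_smul, hT, hV, hN]

end Hubbard

/-! ### Translations and reflections of the fermionic torus -/

section Torus

variable {d L : ℕ} [NeZero L]

namespace FermionTorus

/-- The site bijection of `FermionTorus d L` induced by a bijection of the torus `(ℤ/Lℤ)^d`,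
through the comparison `equivTorusSite`. [folklore] -/
def ofTorusEquiv (g : TorusSite d L ≃ TorusSite d L) : FermionTorus d L ≃ FermionTorus d L :=
  equivTorusSite.trans (g.trans equivTorusSite.symm)

/-- `toTorusSite (ofTorusEquiv g x) = g (toTorusSite x)`. [folklore] -/
@[simp] theorem toTorusSite_ofTorusEquiv (g : TorusSite d L ≃ TorusSite d L) (x : FermionTorus d L) :
    toTorusSite (ofTorusEquiv g x) = g (toTorusSite x) := by
  simp [ofTorusEquiv, equivTorusSite]

/-- `ofTorusEquiv g (ofTorusSite a) = ofTorusSite (g a)`. [folklore] -/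
theorem ofTorusEquiv_ofTorusSite (g : TorusSite d L ≃ TorusSite d L) (a : TorusSite d L) :
    ofTorusEquiv g (ofTorusSite a) = ofTorusSite (g a) := by
  simp [ofTorusEquiv, equivTorusSite]

end FermionTorus

/-- Translations are automorphisms of the nearest-neighbour torus graph (Mathlib's
`circulantGraph_adj_translate`). [cite: FriedliVelenik2017, §3.1 (translation invariance)] -/
theorem fermionTorusGraph_adj_addRight (v : TorusSite d L) (x y : FermionTorus d L) :
    (fermionTorusGraph d L).Adj (FermionTorus.ofTorusEquiv (Equiv.addRight v) x)
        (FermionTorus.ofTorusEquiv (Equiv.addRight v) y) ↔ (fermionTorusGraph d L).Adj x y := by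
  rw [fermionTorusGraph_adj, fermionTorusGraph_adj, FermionTorus.toTorusSite_ofTorusEquiv,
    FermionTorus.toTorusSite_ofTorusEquiv, Equiv.coe_addRight]
  exact SimpleGraph.circulantGraph_adj_translate

/-- The reflection `x ↦ -x` is an automorphism of the nearest-neighbour torus graph.
[cite: BenfattoGiulianiMastropietro2006, §2.1 (symmetry (4), parity)] -/
theorem fermionTorusGraph_adj_neg (x y : FermionTorus d L) :
    (fermionTorusGraph d L).Adj (FermionTorus.ofTorusEquiv (Equiv.neg _) x)
        (FermionTorus.ofTorusEquiv (Equiv.neg _) y) ↔ (fermionTorusGraph d L).Adj x y := by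
  rw [fermionTorusGraph_adj, fermionTorusGraph_adj, FermionTorus.toTorusSite_ofTorusEquiv,
    FermionTorus.toTorusSite_ofTorusEquiv]
  try simp only [Equiv.neg_apply]
  rw [torusGraph_adj_iff, torusGraph_adj_iff, ne_eq, ne_eq, neg_inj.not]
  refine and_congr_right fun _ => ?_
  constructor
  · rintro (⟨i, h⟩ | ⟨i, h⟩)
    · exact Or.inr ⟨i, by rw [← neg_neg y.toTorusSite, h]; abel⟩
    · exact Or.inl ⟨i, by rw [← neg_neg x.toTorusSite, h]; abel⟩
  · rintro (⟨i, h⟩ | ⟨i, h⟩)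
    · exact Or.inr ⟨i, by rw [h]; abel⟩
    · exact Or.inl ⟨i, by rw [h]; abel⟩

/-- **Translation invariance of the grand-canonical Hubbard Hamiltonian on the torus**:
`Γ_v (H_L - μN) Γ_v⁻¹ = H_L - μN` for the relabelling by `x ↦ x + v`.
[cite: BenfattoGiulianiMastropietro2006, §2.2 (translation invariance)] -/
theorem relabel_addRight_hubbardTorusWith (v : TorusSite d L) (t U μ : ℝ) :
    relabel (Orb.mapEquiv (FermionTorus.ofTorusEquiv (Equiv.addRight v)))
      (hubbardTorusWith d L t U μ) = hubbardTorusWith d L t U μ :=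
  relabel_hamiltonianWith _ _ _ (fermionTorusGraph_adj_addRight v) t U μ

/-- **Parity invariance of the grand-canonical Hubbard Hamiltonian on the torus** (relabelling
by `x ↦ -x`). [cite: BenfattoGiulianiMastropietro2006, §2.1 (symmetry (4), parity)] -/
theorem relabel_neg_hubbardTorusWith (t U μ : ℝ) :
    relabel (Orb.mapEquiv (FermionTorus.ofTorusEquiv (Equiv.neg (TorusSite d L))))
      (hubbardTorusWith d L t U μ) = hubbardTorusWith d L t U μ :=
  relabel_hamiltonianWith _ _ _ fermionTorusGraph_adj_neg t U μ

/-- `Torus.proj` is additive (a private copy of `Literature.Probability.LatticeModels.Torus.proj_add`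
of `TwoPointLogConvex.lean`, not imported here to keep the dependencies of this file small). [folklore] -/
private theorem torusProj_add (L : ℕ) (x v : Site d) :
    Torus.proj L (x + v) = Torus.proj L x + Torus.proj L v := by
  funext i
  simp

/-- `Torus.proj` commutes with negation (a private copy of `Torus.proj_neg` of
`PairCorrelationsProofs.lean`, not imported here). [folklore] -/
private theorem torusProj_neg (L : ℕ) (x : Site d) : Torus.proj L (-x) = -Torus.proj L x := by
  funext i
  simp

end Torus

/-! ### Lattice symmetries of the finite-volume two-point function of `bgm_two_point_limit` -/

section TwoPoint

/-- **Translation invariance of the finite-volume two-point function** of the 2D Hubbard torus: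
`⟨c†_{x+v,σ} c_{y+v,σ'}⟩_{β,L} = ⟨c†_{xσ} c_{yσ'}⟩_{β,L}` for all `β, U, μ, L` and all
`x, y, v ∈ ℤ²` (periodic boundary conditions make the interacting Gibbs state translation
invariant; BGM's `S(𝐱,𝐲) = S(𝐱 - 𝐲)`, (1.4) and §2.2). [cite: BenfattoGiulianiMastropietro2006, §1.2 eq. (1.4) and §2.2] -/
theorem hubbardThermalTwoPoint_add_right (β U μ : ℝ) (L : ℕ) (x y v : Site 2) (σ σ' : Fin 2) :
    hubbardThermalTwoPoint β U μ L (x + v) (y + v) σ σ' = hubbardThermalTwoPoint β U μ L x y σ σ' := by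
  unfold hubbardThermalTwoPoint
  split_ifs with hL
  · rfl
  · haveI : NeZero L := ⟨hL⟩
    have hx : FermionTorus.ofTorusSite (Torus.proj L (x + v)) =
        FermionTorus.ofTorusEquiv (Equiv.addRight (Torus.proj L v))
          (FermionTorus.ofTorusSite (Torus.proj L x)) := by
      rw [FermionTorus.ofTorusEquiv_ofTorusSite, Equiv.coe_addRight, torusProj_add]
    have hy : FermionTorus.ofTorusSite (Torus.proj L (y + v)) =
        FermionTorus.ofTorusEquiv (Equiv.addRight (Torus.proj L v))
          (FermionTorus.ofTorusSite (Torus.proj L y)) := by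
      rw [FermionTorus.ofTorusEquiv_ofTorusSite, Equiv.coe_addRight, torusProj_add]
    -- `convert`, not `rw`: the `DecidableEq` instance on the orbitals synthesised inside the
    -- definition of `hubbardThermalTwoPoint` (`instDecidableEqLex`) differs syntactically from
    -- the one derived from the linear order in the general lemmas (closed by `Subsingleton.elim`).
    have key := thermalCorr_relabel
      (Orb.mapEquiv (FermionTorus.ofTorusEquiv (Equiv.addRight (Torus.proj L v)))) β
      (hubbardTorusWith 2 L 1 U μ)
      (creation (orb (FermionTorus.ofTorusSite (Torus.proj L x)) σ))
      (annihilation (orb (FermionTorus.ofTorusSite (Torus.proj L y)) σ'))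
    rw [relabel_addRight_hubbardTorusWith, relabel_creation, relabel_annihilation, Orb.mapEquiv_orb,
      Orb.mapEquiv_orb, ← hx, ← hy] at key
    convert key using 2

/-- Hence the finite-volume two-point function only depends on the difference `y - x`:
`⟨c†_{xσ} c_{yσ'}⟩_{β,L} = ⟨c†_{0σ} c_{y-x,σ'}⟩_{β,L}`. [cite: BenfattoGiulianiMastropietro2006, §1.2 eq. (1.4)] -/
theorem hubbardThermalTwoPoint_eq_sub (β U μ : ℝ) (L : ℕ) (x y : Site 2) (σ σ' : Fin 2) :
    hubbardThermalTwoPoint β U μ L x y σ σ' = hubbardThermalTwoPoint β U μ L 0 (y - x) σ σ' := by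
  rw [← hubbardThermalTwoPoint_add_right β U μ L x y (-x), add_neg_cancel, ← sub_eq_add_neg]

/-- **Parity invariance of the finite-volume two-point function**:
`⟨c†_{-x,σ} c_{-y,σ'}⟩_{β,L} = ⟨c†_{xσ} c_{yσ'}⟩_{β,L}`. [cite: BenfattoGiulianiMastropietro2006, §2.1 (symmetry (4), parity)] -/
theorem hubbardThermalTwoPoint_neg (β U μ : ℝ) (L : ℕ) (x y : Site 2) (σ σ' : Fin 2) :
    hubbardThermalTwoPoint β U μ L (-x) (-y) σ σ' = hubbardThermalTwoPoint β U μ L x y σ σ' := by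
  unfold hubbardThermalTwoPoint
  split_ifs with hL
  · rfl
  · haveI : NeZero L := ⟨hL⟩
    have hx : FermionTorus.ofTorusSite (Torus.proj L (-x)) =
        FermionTorus.ofTorusEquiv (Equiv.neg (TorusSite 2 L))
          (FermionTorus.ofTorusSite (Torus.proj L x)) := by
      rw [FermionTorus.ofTorusEquiv_ofTorusSite, Equiv.neg_apply, torusProj_neg]
    have hy : FermionTorus.ofTorusSite (Torus.proj L (-y)) =
        FermionTorus.ofTorusEquiv (Equiv.neg (TorusSite 2 L))
          (FermionTorus.ofTorusSite (Torus.proj L y)) := by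
      rw [FermionTorus.ofTorusEquiv_ofTorusSite, Equiv.neg_apply, torusProj_neg]
    have key := thermalCorr_relabel
      (Orb.mapEquiv (FermionTorus.ofTorusEquiv (Equiv.neg (TorusSite 2 L)))) β
      (hubbardTorusWith 2 L 1 U μ)
      (creation (orb (FermionTorus.ofTorusSite (Torus.proj L x)) σ))
      (annihilation (orb (FermionTorus.ofTorusSite (Torus.proj L y)) σ'))
    rw [relabel_neg_hubbardTorusWith, relabel_creation, relabel_annihilation, Orb.mapEquiv_orb,
      Orb.mapEquiv_orb, ← hx, ← hy] at key
    convert key using 2  -- instance mismatch, see `hubbardThermalTwoPoint_add_right`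

/-- Hence the two-point function is symmetric in its sites as a function of the difference:
`⟨c†_{xσ} c_{yσ'}⟩_{β,L} = ⟨c†_{yσ} c_{xσ'}⟩_{β,L}` (translation by `-(x+y)` composed with parity).
[cite: BenfattoGiulianiMastropietro2006, §2.1 (symmetry (4), parity)] -/
theorem hubbardThermalTwoPoint_swap_sites (β U μ : ℝ) (L : ℕ) (x y : Site 2) (σ σ' : Fin 2) :
    hubbardThermalTwoPoint β U μ L x y σ σ' = hubbardThermalTwoPoint β U μ L y x σ σ' := by
  have h := hubbardThermalTwoPoint_add_right β U μ L (-x) (-y) (x + y) σ σ'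
  rw [show -x + (x + y) = y by abel, show -y + (x + y) = x by abel, hubbardThermalTwoPoint_neg] at h
  exact h.symm

/-- **Spin-exchange invariance of the finite-volume two-point function**:
`⟨c†_{x,σ̄} c_{y,σ̄'}⟩_{β,L} = ⟨c†_{xσ} c_{yσ'}⟩_{β,L}` with `σ̄ = 1 - σ` (no magnetic field: the Gibbs
state is invariant under `↑ ↔ ↓`). [cite: BenfattoGiulianiMastropietro2006, §2.1 (symmetry (1), spin exchange)] -/
theorem hubbardThermalTwoPoint_spin_swap (β U μ : ℝ) (L : ℕ) (x y : Site 2) (σ σ' : Fin 2) :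
    hubbardThermalTwoPoint β U μ L x y (Equiv.swap (0 : Fin 2) 1 σ) (Equiv.swap (0 : Fin 2) 1 σ') =
      hubbardThermalTwoPoint β U μ L x y σ σ' := by
  unfold hubbardThermalTwoPoint
  split_ifs with hL
  · rfl
  · haveI : NeZero L := ⟨hL⟩
    have key := thermalCorr_relabel (Orb.spinSwap : Orb (FermionTorus 2 L) ≃ _) β
      (hubbardTorusWith 2 L 1 U μ)
      (creation (orb (FermionTorus.ofTorusSite (Torus.proj L x)) σ))
      (annihilation (orb (FermionTorus.ofTorusSite (Torus.proj L y)) σ'))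
    rw [hubbardTorusWith, relabel_spinSwap_hamiltonianWith, ← hubbardTorusWith, relabel_creation,
      relabel_annihilation, Orb.spinSwap_orb, Orb.spinSwap_orb] at key
    convert key using 2  -- instance mismatch, see `hubbardThermalTwoPoint_add_right`

/-- In particular the two equal-spin two-point functions coincide:
`⟨c†_{x↓} c_{y↓}⟩_{β,L} = ⟨c†_{x↑} c_{y↑}⟩_{β,L}`. [cite: BenfattoGiulianiMastropietro2006, §2.1 (symmetry (1), spin exchange)] -/
theorem hubbardThermalTwoPoint_one_one (β U μ : ℝ) (L : ℕ) (x y : Site 2) :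
    hubbardThermalTwoPoint β U μ L x y 1 1 = hubbardThermalTwoPoint β U μ L x y 0 0 := by
  rw [← hubbardThermalTwoPoint_spin_swap β U μ L x y 0 0, Equiv.swap_apply_left]

end TwoPoint

end Literature.MathematicalPhysics.QuantumLattice

end
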